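import Summits.BirchSwinnertonDyer.BirchSwinnertonDyer.Theorems.QuadraticBranchSignedControlPlusEtaNonsurjConjADoorBSDRankOneCoeff
import Summits.BirchSwinnertonDyer.BirchSwinnertonDyer.Theorems.QuadraticBranchSignedControlPlusEtaNonsurjConjADoorFamilyBSDRecords
import HarnessLib

/-!
# Route `QuadraticBranchSignedControl` (rung K8, cell `bsd-potss`), residual crux `PlusEtaMainConjectureNonsurj`
# (stmt-BirchSwinnertonDyer-19606): FAMILY `BSD_5` RECORD R1N — `MissingPPartAt W 5` on the `λ⁻ = 1` prime-`L` rank-one family row c5a:−19 (door L4),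
# modulo named published facts and DISPLAYED NUMERICS ONLY (seat `bsd-potss-k8eta-c2` g22)

WHAT. p720481's `missingPPartAt_r1_c5a_m19_5_of_heckeEigenHom` displays the crux instance C-cc-1@row; c5a:−19 has PARI minus-`η` `(λ, μ) = (1, 0)` and
(g19 etacomp j319629) `ν = 0`, `#Ш_an = 1`, `Tam = 8`, `#tors = 1`, so that instance follows from the three numerical data (N1)–(N3) by this seat's
`EtaConjADoorBSDRankOne.minusLeadingValuationAt_zero_of_unit_coeff_of_indivisible` (p724126). (The other two family rank-one record rows c5d:8 and
c5e:37 have `λ⁻ = 3` — C-cc-1 predicts `v₅(coeff₁ L₅⁻) = 2·2 + 1 = 5` and `0 + 1 = 1` there; not testable with `ellpadiclambdamu`.)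

HONEST FRAMING (cell `bsd-potss`; FULL-BSD rank ≤ 1 programme, HUMAN RULING D-0036/D-0074): per-row RECORD, CONDITIONAL on the named facts and displayed
per-row data (GRH class numbers / Hecke eigenvalue, PARI `λ^±, μ^±`, `ellanalyticrank`, `ellrank` generator + `5`-divisibility, `#Ш_an`, `Tam`, `#tors`,
the twin `V` with its tower clause); numerics are evidence; `BSD(W,5)` ASSERTED for no pair; C-cc-1 NOT proved; crux and route OPEN; nothing booked.
`--supports stmt-BirchSwinnertonDyer-19606`.

References: [Kobayashi2003] Thm. 1.2, 2.2, §4, Thm. 4.1, 6.2–7.4, 9.3; [Kobayashi2013]; [KitajimaOtsuki2018] Main Thm. 1.3; [GrossZagier1986] I (7.3);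
[Mazur1978] Cor. 4.1; [Miller2011LMS] Def. 1.1; [CoatesSujatha2005] §3 (A); [DeoRaySujatha2023] Thm. 3.8–3.9.
-/

set_option autoImplicit false
set_option linter.dupNamespace false
noncomputable section

open scoped Classical nonZeroDivisors

open CongruenceSubgroup NumberField Field WeierstrassCurve
open Literature.NumberTheory.EllipticCurves Literature.NumberTheory.EllipticCurves.ModularForms
  Literature.NumberTheory.EllipticCurves.Rank1Residual Literature.NumberTheory.EllipticCurves.Rank1Residual.Typed
  Literature.NumberTheory.GaloisRepresentations Literature.NumberTheory.GaloisCohomology Literature.NumberTheory.NumberFields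
  Literature.NumberTheory.EllipticCurves.GreenbergVatsal2000 ZpExtension
open Summit.BirchSwinnertonDyer.Rank1Residual Summit.BirchSwinnertonDyer.Rank1Residual.Additive
open Summit.BirchSwinnertonDyer.Rank1Residual.X11b (isElliptic_of_discOf_ne_zero)
open Summit.BirchSwinnertonDyer.BirchSwinnertonDyer.Theorems

namespace Summit.BirchSwinnertonDyer.BirchSwinnertonDyer.Theorems.EtaConjADoorFamilyBSDRecords

/-- **`MissingPPartAt W 5` — `ord_5 #Ш(W) = ord_5 #Ш_an(W)` (from Miller's `BSDp W 5`) — for the CONGRUENT-class prime-`L` rank-one partner c5a:-19,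
granted ONE good `a_5 = 0` globally minimal model `V` of `W^{(5)}` with non-onto `5`-adic tower, modulo named facts and DISPLAYED NUMERICS ONLY (no
conjecture instance: the `λ⁻ = 1` shape)** (`W = [0, 0, 0, -3113625, -4421482875]`, non-CM, `N_W = 9422100`; kit j326606/j327196 (k8eta-c2 g21) +
g19 etacomp j319629 (ν, #Ш_an, Tam) (147+623 s, GRH): `ε(W) = −1`, PARI plus-`η` `(λ, μ) = (1, 0)`, `r_an(W) = 1` (`k8eta-c2 g19 etanc`); `h(ℚ(P)) =
20` (`[10,2]`); eigen dimensions `(d₁,d₂,d₃,d₄) = (0,1,0,0)`; Hecke datum (conjA g13 hecke13 engine, kit j327196): `Tr ρ̄(y) = 4`, `T_y` acts on the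
tautological line by `c = 1` — verdict TWIST-TYPE (`T_y = −Tr`: the line belongs to `ρ̄ ⊗ ε′`, not to `ρ̄`; (c2) for `W` holds) — door L4
(Hecke-refined eigen-test) passes) from the ROW ALONE — named facts `hGZK hmod hnf hM h12 hKO hGZ h74 h22 h41 h6273` (GZK, modularity, newforms,
Mazur `p ∤ c₀`, Kobayashi Thm. 1.2 / 2.2 / 4.1 / 6.2–7.4, Kitajima–Otsuki Thm. 1.3, Gross–Zagier I (7.3); Poitou–Tate and the layer comparison are
tree theorems); displayed: `r_an(W) = 1`, the twin `V` with the tower clause, `(L_5⁺(V,η,X)) = (X)`, and — INSTEAD of the crux C-cc-1 at the row —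
three NUMERICAL data that make its `δ = 0` law trivially true here: (N1) every period-normalised minus branch function `L_5⁻(V,η,X)` has a UNIT
`X`-coefficient (PARI minus-`η` `(λ, μ) = (1, 0)`), (N2) no generator of `W(ℚ)/tors` is `5`-divisible in `W(ℚ_5)` (kit: `ν = 0`), (N3)
`v_5(q·Tam/#tors²) = 0` for `q = #Ш_an(W)` (kit: `#Ш_an = 1`, `Tam = 8`, `#tors = 1`), the class-group datum. Instance of
`EtaConjADoorBSDRankOne.bsdp_r1_of_heckeEigenHom` with `hcc1 :=` `minusLeadingValuationAt_zero_of_unit_coeff_of_indivisible` (k8eta-c2 g22).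
CONDITIONAL; nothing booked. [cite: Kobayashi2003, §4 (p. 8), Thm. 2.2 (p. 5)] [cite: CoatesSujatha2005, §3 (A) and Thm. 3.4] [cite: Zywina2015,
Thm. 1.4] -/
theorem missingPPartAt_r1n_c5a_m19_5_of_heckeEigenHom
    (hGZK : rank_eq_analyticRank_of_analyticRank_le_one) (hmod : hasEntireLFunction_rat)
    (hnf : exists_isNewformOf) (hM : mazur_not_dvd_maninConstant_of_odd)
    (h12 : Kobayashi2003.thm12_signedSelmerDual_finite_torsion)
    (hKO : KitajimaOtsuki2018.mainThm13_etaSignedSelmerDual_noFiniteSubmodule)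
    (hGZ : GrossZagier1986_thm_I_7_3) (h74 : Kobayashi2003.thm74_etaEvenMC_iff_etaOddMC)
    (h22 : Kobayashi2003.thm22_etaSignedSelmerDual_finite_torsion)
    (h41 : Kobayashi2003.thm41_plusEtaCharIdeal_dvd)
    (h6273 : Kobayashi2003.thm62_63_73_etaColemanPoitouTate) [Fact (5 : ℕ).Prime]
    (W : WeierstrassCurve ℚ) (hW : W = (⟨0, 0, 0, (-3113625), (-4421482875)⟩ : WeierstrassCurve ℚ)) (hr : W.analyticRank = 1)
    (V : WeierstrassCurve ℚ) [V.IsElliptic] [V.IsGloballyMinimal] (C : VariableChange ℚ)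
    (hC : C • W.quadraticTwist 5 = V)
    (hgood : V.HasGoodReductionAtPrime 5) (hap : V.frobeniusTrace 5 = 0)
    (hns : ¬ ∀ m : ℕ, V.HasSurjectiveModNGaloisRep (5 ^ m : ℕ))
    (hX : ∀ {N : ℕ} [NeZero N] {f : CuspForm (Gamma0 N) 2}, IsNewformOf V f →
      ∀ (ϖ : ℚ), (if Even (5 / 2) then (ϖ : ℝ) * V.realPeriodRat = plusPeriod f
          else (ϖ : ℝ) * V.imaginaryPeriodRat = minusPeriod f) →
      ∀ (Lη : IwasawaAlgebra 5), IsQuadraticBranchPlusLFunction f 5 ϖ Lη →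
        Ideal.span {Lη} = Ideal.span {(PowerSeries.X : IwasawaAlgebra 5)})
    (hP : haveI : W.IsElliptic := hW ▸ Summit.BirchSwinnertonDyer.BirchSwinnertonDyer.Theorems.EtaConjADoorFamilyRecords.isElliptic_c5a_m19
      haveI : NeZero (5 : ℕ) := ⟨by norm_num⟩
      haveI : NumberField (W.divisionField 5) := NumberField.mk
      ∃ P : geomTorsion W ((5 : ℕ) : ℤ), P ≠ 0 ∧
        ∀ K : IntermediateField ℚ (W.divisionField 5),
          K = IntermediateField.fixedField
            ((MulAction.stabilizer (absoluteGaloisGroup ℚ) P).map (absRestrictNormalHom (W.divisionField 5))) →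
        ∀ μ : Additive (ClassGroup (𝓞 K)) →+ ZMod 5,
          (∀ (τ : absoluteGaloisGroup ℚ) (σ : K ≃ₐ[ℚ] K) (a : ℕ),
              (∀ x : K, absRestrictNormalHom (W.divisionField 5) τ (x : W.divisionField 5) =
                ((σ x : K) : W.divisionField 5)) → τ • P = a • P →
              ∀ (I J : (Ideal (𝓞 K))⁰),
                (J : Ideal (𝓞 K)) = (I : Ideal (𝓞 K)).map (AmbiguousClass.intAut σ : 𝓞 K →+* 𝓞 K) →
                μ (Additive.ofMul (ClassGroup.mk0 J)) = a • μ (Additive.ofMul (ClassGroup.mk0 I))) →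
          (∀ (τ τ₁ : absoluteGaloisGroup ℚ) (a a₁ b : ℕ) (Q : geomTorsion W ((5 : ℕ) : ℤ)),
              τ • P = a • P + Q → τ₁ • P = a₁ • P → τ₁ • Q = b • Q → (a₁ : ZMod 5) ≠ (b : ZMod 5) →
              ∀ I : (Ideal (𝓞 K))⁰,
                μ (Additive.ofMul (classGroupNorm K (W.divisionField 5) (ClassGroup.mulEquiv
                  (AmbiguousClass.intAut (absRestrictNormalHom (W.divisionField 5) τ))
                    (classGroupExtend K (W.divisionField 5) (ClassGroup.mk0 I))))) =
                  (Nat.card ((W.divisionField 5) ≃ₐ[K] (W.divisionField 5)) * a) •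
                    μ (Additive.ofMul (ClassGroup.mk0 I))) →
          μ = 0)
    (hcoef : haveI : W.IsElliptic := hW ▸ Summit.BirchSwinnertonDyer.BirchSwinnertonDyer.Theorems.EtaConjADoorFamilyRecords.isElliptic_c5a_m19
      ∀ (V' : WeierstrassCurve ℚ) [V'.IsElliptic] [V'.IsGloballyMinimal] (C' : VariableChange ℚ)
        {N : ℕ} [NeZero N] {f : CuspForm (Gamma0 N) 2},
        C' • W.quadraticTwist 5 = V' → V'.HasGoodReductionAtPrime 5 → V'.frobeniusTrace 5 = 0 → IsNewformOf V' f →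
        ∀ (ϖ : ℚ), (if Even (5 / 2) then (ϖ : ℝ) * V'.realPeriodRat = plusPeriod f
            else (ϖ : ℝ) * V'.imaginaryPeriodRat = minusPeriod f) →
        ∀ (L : IwasawaAlgebra 5), IsQuadraticBranchMinusLFunction f 5 ϖ L → IsUnit (PowerSeries.coeff 1 L))
    (hnd : haveI : W.IsElliptic := hW ▸ Summit.BirchSwinnertonDyer.BirchSwinnertonDyer.Theorems.EtaConjADoorFamilyRecords.isElliptic_c5a_m19
      ∀ P : W.toAffine.Point, ¬ IsOfFinAddOrder P →
        (∀ R : W.toAffine.Point, ∃ (k : ℤ) (T : W.toAffine.Point), IsOfFinAddOrder T ∧ R = k • P + T) →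
        ∀ Q : (W.baseChange ℚ_[5]).toAffine.Point, 5 • Q ≠ W.toPadicPoint 5 P)
    (hval : haveI : W.IsElliptic := hW ▸ Summit.BirchSwinnertonDyer.BirchSwinnertonDyer.Theorems.EtaConjADoorFamilyRecords.isElliptic_c5a_m19
      haveI : W.IsGloballyMinimal := hW ▸ Summit.BirchSwinnertonDyer.BirchSwinnertonDyer.Theorems.EtaConjADoorFamilyBSDRecords.isGloballyMinimal_c5a_m19
      ∀ q : ℚ, shaAn W = (q : ℂ) → padicValRat 5 (q * W.tamagawaProduct / (W.torsionOrder : ℚ) ^ 2) = 0) :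
    MissingPPartAt W 5 := by
  rw [← show ((-1 : ℚ) ^ ((5 : ℕ) / 2) * ((5 : ℕ) : ℚ)) = (5 : ℚ) by norm_num] at hcoef
  subst hW
  haveI : (⟨0, 0, 0, (-3113625), (-4421482875)⟩ : WeierstrassCurve ℚ).IsElliptic := Summit.BirchSwinnertonDyer.BirchSwinnertonDyer.Theorems.EtaConjADoorFamilyRecords.isElliptic_c5a_m19
  haveI : (⟨0, 0, 0, (-3113625), (-4421482875)⟩ : WeierstrassCurve ℚ).IsGloballyMinimal := Summit.BirchSwinnertonDyer.BirchSwinnertonDyer.Theorems.EtaConjADoorFamilyBSDRecords.isGloballyMinimal_c5a_m19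
  haveI : NeZero (5 : ℕ) := ⟨by norm_num⟩
  haveI : Finite (⟨0, 0, 0, (-3113625), (-4421482875)⟩ : WeierstrassCurve ℚ).sha := (hGZK _ (by omega)).2
  exact missingPPartAt_of_bsdp _ 5 (EtaConjADoorBSDRankOne.bsdp_r1_of_heckeEigenHom _ 5 hGZK hmod hnf hM h12 hKO hGZ h74 h22 h41 h6273 (le_refl 5) hr V C
    (by rw [show ((-1 : ℚ) ^ ((5 : ℕ) / 2) * ((5 : ℕ) : ℚ)) = 5 by norm_num]; exact hC) hgood hap hns hX hP
    (EtaConjADoorBSDRankOne.minusLeadingValuationAt_zero_of_unit_coeff_of_indivisible _ 5 hcoef hnd hval))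

end Summit.BirchSwinnertonDyer.BirchSwinnertonDyer.Theorems.EtaConjADoorFamilyBSDRecords

end
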